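import Literature.AlgebraicGeometry.Motives.HypersurfaceFundamentalClass
import Literature.AlgebraicGeometry.Motives.CartierDivisorIntersectionSubvariety
import Literature.AlgebraicGeometry.Motives.ProjectiveSpaceHyperplaneMultiplicity
import Literature.AlgebraicGeometry.Motives.LinesGenerateChowOneProofs
import HarnessLib

/-!
# Linear sections of a hypersurface: `[X ∩ M] = H_X^c ∩ [X]` in `CH_*(X)`

Mboro, *Remarks on the `CH₂` of cubic hypersurfaces* (arXiv:1701.04488; Geom. Dedicata 2019),
proof of Prop. 1.4 (p. 8): for a smooth cubic `X ⊂ ℙⁿ⁺¹` and a `3`-plane `P₀` with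
`S := P₀ ∩ X` a cubic surface, "in `CH₂(X)`, we have `H_X^{n-2} = [S]`". This file proves that step
of the printed proof of `Mboro2018_chowTwo_cubic` (input (a), `Motives/LinearSubspacesGenerateChow`)
in the generality of Fulton, *Intersection Theory*, Ch. 2: for a hypersurface `X = V₊(F) ⊆ ℙ^{d+1}`
(`F` prime) and a linear subspace `M = V₊(ℓ₁, …, ℓ_c) ⊄ X`, the cycle `[X ∩ M]` — realised on `X`
as the iterated section cycle `(i^*V₊(ℓ_c)) · (⋯ ((i^*V₊(ℓ₁)) · [X]))`, whose push-forward to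
`ℙ^{d+1}` is the intersection cycle `V₊(F) · [M]` (the Weil divisor of `F|_M`) — has class
`c₁(𝒪_X(1))ᶜ ∩ [X]` in `CH_{d-c}(X)`, independent of `M`. Only Case 1 (proper intersection) of
Fulton's Thm. 2.4 is needed, on the linear subspaces of the flag `V₊(ℓ₁) ⊃ V₊(ℓ₁, ℓ₂) ⊃ ⋯ ⊃ M`.

* `CartierDivisor.interCycle_primeInter_comm` — **`D · (E · [V]) = E · (D · [V])` as cycles** for
  effective `D, E` meeting properly on the subvariety `V` of a projective variety (Thm. 2.4, Case 1,
  on `V`, pushed forward; Fulton, Cor. 2.4.2 at the level of cycles);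
  `CartierDivisor.interCycle_primeInter_eq_of_primeInter_eq_primeCycle` — `H · (D · [V]) = D · [V']`
  when `H · [V] = [V']`; `CartierDivisor.IsEffective.primeInter_genericPoint` — `D · [X] = [D]`;
  `CartierDivisor.iterInter` — iterated intersection `D_c · (⋯ (D₁ · s))`.
* `ProjSpace.primeInter_formDivisor_last_eq_primeCycle` — `V₊(ℓ_{c+1}) · [V₊(ℓ₁..ℓ_c)] = [V₊(ℓ₁..ℓ_{c+1})]`
  (multiplicity one, from `Motives/ProjectiveSpaceHyperplaneMultiplicity`);
  `ProjSpace.iterInter_formDivisor_cycle_eq_primeInter` — **`[V₊(F)] · H₁ ⋯ H_c = V₊(F) · [M]`** on `ℙᴺ`.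
* `ProjSpace.hyperplaneSectionOnIter` — `c₁(𝒪_X(1))ᶜ ∩ - : CH_{n+c}(X) → CH_n(X)` for `X ⊆ ℙᴺ`;
  `ProjSpace.mk_iterInter_eq_hyperplaneSectionOnIter` — iterated sections by any hyperplanes
  `⊅ X` represent it.
* `Hypersurface.map_iterInter_primeCycle_eq_primeInter` — **`i_*((i^*H_c) ⋯ (i^*H₁) · [X]) = V₊(F) · [M]`**;
  `Hypersurface.mk_iterInter_primeCycle_eq_hyperplaneSectionOnIter` — **`[X ∩ M] = H_X^c ∩ [X]`**
  (Mboro's `[S] = H_X^{n-2}`); `Hypersurface.mk_iterInter_primeCycle_eq_mk_iterInter_primeCycle` —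
  independence of `M`.

Everything is proved; the only definitions are the iterates `CartierDivisor.iterInter`,
`ProjSpace.hyperplaneSectionOnIter`.

## References

* R. Mboro, *Remarks on the CH₂ of cubic hypersurfaces*, Geom. Dedicata 200 (2019) 1–25,
  doi:10.1007/s10711-018-0355-0, arXiv:1701.04488: proof of Prop. 1.4 (p. 8). [Mboro2018]
* W. Fulton, *Intersection Theory*, 2nd ed., Springer (1998): Def. 2.3 (p. 33), Prop. 2.3 (p. 34),
  Thm. 2.4 and Case 1 of its proof (pp. 35–36), Cor. 2.4.2 / Def. 2.4.2 (p. 38), §2.5 and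
  Example 2.5.1 (p. 41). [Fulton1998]
* R. Hartshorne, *Algebraic Geometry*, GTM 52 (1977), I Ex. 2.11 (linear varieties). [Hartshorne1977]
* The Stacks Project, Tag 0A21 (dimension formula). [StacksProject]
-/

noncomputable section

universe u

open CategoryTheory AlgebraicGeometry Order Topology IsLocalRing
open Literature.AlgebraicGeometry.Motives.RatFn Literature.RingTheory.OrderOfVanishing
open Literature.AlgebraicGeometry.Motives.Segre

attribute [local instance] MvPolynomial.gradedAlgebra

namespace Literature.AlgebraicGeometry.Motives

section General

variable {K : Type u} [Field K] {X : SchemeOver K} [IsIntegral X.left] [LocallyOfFiniteType X.hom]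

/-- **Specialisations of equal (finite) dimension are trivial**: if `a ⤳ b` and
`dim closure {b} = dim closure {a} < ∞` then `a = b`. [folklore] -/
theorem eq_of_specializes_of_height_eq {Y : Scheme.{u}} {a b : Y} (hab : a ⤳ b)
    (h : height b = height a) (hfin : height a < ⊤) : a = b := by
  have hle : b ≤ a := Scheme.le_iff_specializes.mpr hab
  by_cases hge : a ≤ b
  · exact (hab.antisymm (Scheme.le_iff_specializes.mp hge)).eq
  · exact absurd h (height_strictMono (lt_of_le_not_ge hle hge) (h ▸ hfin)).ne

/-- Arithmetic of the dimension formula: from `a + c = b` with `a, b` finite, `c = 1 ↔ a + 1 = b`.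
[folklore] -/
theorem ENat.eq_one_iff_of_add_eq {a b : ℕ} {c : ℕ∞} (h : (a : ℕ∞) + c = b) :
    c = 1 ↔ (a : ℕ∞) + 1 = b := by
  have hct : c ≠ ⊤ := by
    rintro rfl
    simp at h
  obtain ⟨m, rfl⟩ := ENat.ne_top_iff_exists.mp hct
  have habm : a + m = b := by exact_mod_cast h
  constructor
  · intro H
    have hm1 : m = 1 := by exact_mod_cast H
    exact_mod_cast (show a + 1 = b by omega)
  · intro H
    have h1 : a + 1 = b := by exact_mod_cast H
    exact_mod_cast (show m = 1 by omega)

/-- **Codimension one means dimension `dim X - 1`** on a variety (dimension formula, Stacks 0A21).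
[cite: StacksProject, Tag 0A21] -/
theorem coheight_eq_one_iff_height (w : X.left) :
    coheight w = 1 ↔ height w + 1 = height (⊤ : ↥X.left) := by
  have hs := Scheme.height_add_coheight_eq_height_top X.hom w
  obtain ⟨a, ha⟩ := ENat.ne_top_iff_exists.mp (height_ne_top_of_locallyOfFiniteType X.hom w)
  obtain ⟨b, hb⟩ := ENat.ne_top_iff_exists.mp (height_ne_top_of_locallyOfFiniteType X.hom (⊤ : ↥X.left))
  rw [← ha, ← hb] at hs ⊢
  exact ENat.eq_one_iff_of_add_eq hs

omit [IsIntegral X.left] in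
/-- **Codimension one in `closure {w}` means dimension `dim closure {w} - 1`**: for `w ⤳ z` on a
variety, the point of `closure {w}` over `z` has codimension one iff `height z + 1 = height w`
(dimension formula on the subvariety `closure {w}`, Stacks 0A21). [cite: StacksProject, Tag 0A21] -/
theorem coheight_ofPointPt_eq_one_iff_height {w z : X.left} (h : w ⤳ z) :
    coheight (ClosedSubvariety.ofPointPt w h) = 1 ↔ height z + 1 = height w := by
  set V := ClosedSubvariety.ofPoint X.left w
  set v : ↥V.carrier := ClosedSubvariety.ofPointPt w h
  have hV_v := Scheme.height_add_coheight_eq_height_top (V.over X.hom).hom v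
  change height v + coheight v = height (⊤ : ↥V.carrier) at hV_v
  rw [height_top_ofPoint, ← height_base_eq_of_isClosedImmersion' V.ι v] at hV_v
  change height z + coheight v = height w at hV_v
  obtain ⟨a, ha⟩ := ENat.ne_top_iff_exists.mp (height_ne_top_of_locallyOfFiniteType X.hom z)
  obtain ⟨b, hb⟩ := ENat.ne_top_iff_exists.mp (height_ne_top_of_locallyOfFiniteType X.hom w)
  rw [← ha, ← hb] at hV_v ⊢
  exact ENat.eq_one_iff_of_add_eq hV_v

namespace CartierDivisor

/-- Every Cartier divisor avoids the generic point (its local equations are nonzero rational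
functions, units at `η`). [folklore] -/
theorem avoids_genericPoint {Y : Scheme.{u}} [IsIntegral Y] (D : CartierDivisor Y) :
    D.Avoids (genericPoint Y) :=
  fun i _ => isUnitAt_genericPoint (D.f_ne_zero i)

/-- **A coefficient of `D · [closure {w}]` on `|D|` is positive**: for an effective `D` avoiding
`w`, a specialisation `w ⤳ z` of dimension `dim closure {w} - 1` lying on `|D|` has positive
coefficient in `D · [closure {w}]` (the local equation is a non-unit of the one-dimensional local
ring of `closure {w}` at `z`). [cite: Fulton1998, Def. 2.3 (p. 33) and §1.2] -/
theorem primeInter_pos_of_not_avoids {D : CartierDivisor X.left} (hD : D.IsEffective) {w z : X.left}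
    (hDw : D.Avoids w) (hwz : w ⤳ z) (hz : height z + 1 = height w) (hDz : ¬ D.Avoids z) :
    0 < D.primeInter w z := by
  set V := ClosedSubvariety.ofPoint X.left w
  have hgen : D.Avoids (V.ι (genericPoint V.carrier)) := by
    change D.Avoids V.genericPoint
    rw [ClosedSubvariety.genericPoint_ofPoint]
    exact hDw
  rw [D.primeInter_apply_of_specializes hwz, pullbackRep_of_avoids _ _ hgen]
  set v : ↥V.carrier := ClosedSubvariety.ofPointPt w hwz
  set E := D.pullbackAvoiding V.ι hgen
  obtain ⟨i, hi⟩ := E.covers v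
  have hu : ¬ IsUnitAt (V.ι v) (D.f i.1) := fun h => hDz (Avoids.of_mem hi h)
  have hu' := hD.not_isUnitAt_pullbackAvoiding V.ι hgen i hi hu
  exact (hD.pullbackAvoiding V.ι hgen).ordAt_pos hi hu' ((coheight_ofPointPt_eq_one_iff_height hwz).2 hz)

/-- **`D · [X] = [D]`** for an effective Cartier divisor `D` on a variety `X` (Fulton, Def. 2.3 with
`V = X ⊄ |D|`: `D · [X] = [j^*D]`, `j = 𝟙`): the cycle `primeInter D η_X` is the Weil divisor of
`D`. At a codimension-one point `w`, both coefficients are `ℓ(𝒪_{X,w}/(t))` for a local equation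
`t` (`ordAt_pullbackAvoiding_ofPoint_eq_toNat_ord_quotient` with `𝔭_η = 0`,
`Scheme.ord_toFunctionField_eq_toNat`). [cite: Fulton1998, Def. 2.3 (p. 33)] -/
theorem IsEffective.primeInter_genericPoint {D : CartierDivisor X.left} (hD : D.IsEffective) :
    D.primeInter (genericPoint X.left) = D.cycle := by
  set η : X.left := genericPoint X.left
  set V := ClosedSubvariety.ofPoint X.left η
  have hgen : D.Avoids (V.ι (genericPoint V.carrier)) := by
    change D.Avoids V.genericPoint
    rw [ClosedSubvariety.genericPoint_ofPoint]
    exact D.avoids_genericPoint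
  ext w
  have hηw : η ⤳ w := (genericPoint_spec X.left).specializes (Set.mem_univ w)
  rw [D.primeInter_apply_of_specializes hηw, pullbackRep_of_avoids _ _ hgen, cycle_apply]
  set v : ↥V.carrier := ClosedSubvariety.ofPointPt η hηw
  by_cases hw : coheight w = 1
  · -- both sides are `ℓ(𝒪_{X,w}/(t))`
    obtain ⟨i, hwi⟩ := D.covers w
    obtain ⟨t, ht⟩ := hD i w hwi
    have ht0 : t ≠ 0 := by
      intro h0
      apply D.f_ne_zero i
      rw [← ht, h0, map_zero]
    have hv : coheight v = 1 :=
      (coheight_ofPointPt_eq_one_iff_height hηw).2 ((coheight_eq_one_iff_height w).1 hw)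
    -- `𝔭_η = 0` in `𝒪_{X,w}`
    have hbot : (maximalIdeal (X.left.presheaf.stalk η)).comap
        (X.left.presheaf.stalkSpecializes hηw).hom = ⊥ := by
      have hm : maximalIdeal (X.left.presheaf.stalk η) = ⊥ := by
        change maximalIdeal X.left.functionField = ⊥
        exact Ideal.eq_bot_of_prime _
      rw [hm]
      refine Ideal.comap_bot_of_injective _ ?_
      change Function.Injective (algebraMap (X.left.presheaf.stalk w) X.left.functionField)
      exact IsFractionRing.injective (X.left.presheaf.stalk w) X.left.functionField
    have htη : t ∉ (maximalIdeal (X.left.presheaf.stalk η)).comap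
        (X.left.presheaf.stalkSpecializes hηw).hom := by
      rw [hbot, Ideal.mem_bot]
      exact ht0
    rw [ordAt_pullbackAvoiding_ofPoint_eq_toNat_ord_quotient hηw hwi ht hgen hv htη,
      D.ordAt_eq_ord hwi, ← ht, Scheme.ord_toFunctionField_eq_toNat hw ht0]
    congr 2
    -- `ord_{A/0}(t̄) = ord_A(t)`
    have key : ∀ (I : Ideal (X.left.presheaf.stalk w)) (hI : I = ⊥),
        Ring.ord (X.left.presheaf.stalk w ⧸ I) (Ideal.Quotient.mk I t) =
          Ring.ord (X.left.presheaf.stalk w) t := by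
      rintro I rfl
      rw [← ord_ringEquiv (RingEquiv.quotientBot (X.left.presheaf.stalk w))]
      rfl
    exact key _ hbot
  · -- off codimension one both sides vanish
    have hv : coheight v ≠ 1 := fun h =>
      hw ((coheight_eq_one_iff_height w).2 ((coheight_ofPointPt_eq_one_iff_height hηw).1 h))
    obtain ⟨j, hj⟩ := (D.pullbackAvoiding V.ι hgen).covers v
    obtain ⟨j', hj'⟩ := D.covers w
    rw [ordAt_eq_ord _ hj, D.ordAt_eq_ord hj', Scheme.ord_eq_zero_of_coheight_neq_one hv,
      Scheme.ord_eq_zero_of_coheight_neq_one hw]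

/-- **`D · (E · [V]) = E · (D · [V])` as cycles, for effective divisors meeting properly on `V`**
(Fulton, Thm. 2.4 / Cor. 2.4.2 at the level of cycles, in the properly-intersecting case): let
`V = closure {w}` be a subvariety of the projective variety `X` contained in neither `|D|` nor
`|E|`, and assume that no subvariety of `V` of codimension one lies in both `|D|` and `|E|`. Then
`D · (E · [V]) = E · (D · [V])` in `Z_*(X)`. Proof: Case 1 of Thm. 2.4 on the variety `V` for the
restricted divisors `j^*D`, `j^*E` (`interCycle_cycle_comm`), pushed forward along `j : V ↪ X`
(`map_interCycle_pullbackAvoiding`, Prop. 2.3 (c)). [cite: Fulton1998, Theorem 2.4 and Cor. 2.4.2 (pp. 35–38)] -/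
theorem interCycle_primeInter_comm [CompactSpace ↥X.left] {D E : CartierDivisor X.left}
    (hD : D.IsEffective) (hE : E.IsEffective) {w : X.left} (hDw : D.Avoids w) (hEw : E.Avoids w)
    (hDE : ∀ z : X.left, w ⤳ z → height z + 1 = height w → D.Avoids z ∨ E.Avoids z) :
    D.interCycle (E.primeInter w) = E.interCycle (D.primeInter w) := by
  set V := ClosedSubvariety.ofPoint X.left w
  haveI : CompactSpace ↥(V.over X.hom).left := V.ι.isClosedEmbedding.compactSpace
  have hgen : V.ι (genericPoint V.carrier) = w := by
    change V.genericPoint = w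
    exact ClosedSubvariety.genericPoint_ofPoint w
  have hDg : D.Avoids ((V.overι (X := X)).left (genericPoint ↥(V.over X.hom).left)) := by
    change D.Avoids (V.ι (genericPoint V.carrier)); rw [hgen]; exact hDw
  have hEg : E.Avoids ((V.overι (X := X)).left (genericPoint ↥(V.over X.hom).left)) := by
    change E.Avoids (V.ι (genericPoint V.carrier)); rw [hgen]; exact hEw
  set D' := D.pullbackAvoiding (V.overι (X := X)).left hDg
  set E' := E.pullbackAvoiding (V.overι (X := X)).left hEg
  have hD'e : D'.IsEffective := hD.pullbackAvoiding _ hDg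
  have hE'e : E'.IsEffective := hE.pullbackAvoiding _ hEg
  -- points of `V` of codimension one have dimension `dim V - 1` in `X`
  have hpt : ∀ v : ↥(V.over X.hom).left, coheight v = 1 → height (V.ι v) + 1 = height w := by
    intro v hv
    have h := (coheight_ofPointPt_eq_one_iff_height (ClosedSubvariety.specializes_ofPoint_ι w v)).1
    exact h hv
  have hsp : ∀ v : ↥(V.over X.hom).left, w ⤳ (V.overι (X := X)).left v :=
    fun v => ClosedSubvariety.specializes_ofPoint_ι w v
  -- Case 1 on `V`
  have hcomm : D'.interCycle E'.cycle = E'.interCycle D'.cycle := by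
    refine interCycle_cycle_comm (X := V.over X.hom) hD'e hE'e fun v hv => ?_
    rcases hDE _ (hsp v) (hpt v hv) with h | h
    · exact Or.inl (Avoids.pullbackAvoiding_of_base _ hDg h)
    · exact Or.inr (Avoids.pullbackAvoiding_of_base _ hEg h)
  -- supports
  have hsuppE : ∀ v, E'.cycle v ≠ 0 → D.Avoids ((V.overι (X := X)).left v) := by
    intro v hv
    rw [cycle_apply] at hv
    have hcoh : coheight v = 1 := E'.coheight_eq_one_of_ordAt_ne_zero hv
    have hnE : ¬ E.Avoids ((V.overι (X := X)).left v) := fun h =>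
      hv (Avoids.pullbackAvoiding_of_base _ hEg h).ordAt_eq_zero
    exact (hDE _ (hsp v) (hpt v hcoh)).resolve_right hnE
  have hsuppD : ∀ v, D'.cycle v ≠ 0 → E.Avoids ((V.overι (X := X)).left v) := by
    intro v hv
    rw [cycle_apply] at hv
    have hcoh : coheight v = 1 := D'.coheight_eq_one_of_ordAt_ne_zero hv
    have hnD : ¬ D.Avoids ((V.overι (X := X)).left v) := fun h =>
      hv (Avoids.pullbackAvoiding_of_base _ hDg h).ordAt_eq_zero
    exact (hDE _ (hsp v) (hpt v hcoh)).resolve_left hnD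
  have h1 := map_interCycle_pullbackAvoiding (V.overι (X := X)) hD hDg hsuppE
    (finite_support_of_compactSpace _)
  have h2 := map_interCycle_pullbackAvoiding (V.overι (X := X)) hE hEg hsuppD
    (finite_support_of_compactSpace _)
  -- `j_*[j^*E] = E · [V]`, `j_*[j^*D] = D · [V]`
  have hgen' : ∀ {C : CartierDivisor X.left}, C.Avoids w →
      C.Avoids ((ClosedSubvariety.ofPoint X.left w).ι
        (genericPoint (ClosedSubvariety.ofPoint X.left w).carrier)) := by
    intro C hC; rw [hgen]; exact hC
  have hE' : AlgebraicCycle.map (V.overι (X := X)).left height height E'.cycle = E.primeInter w := by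
    rw [primeInter, pullbackRep_of_avoids _ _ (hgen' hEw)]
    rfl
  have hD' : AlgebraicCycle.map (V.overι (X := X)).left height height D'.cycle = D.primeInter w := by
    rw [primeInter, pullbackRep_of_avoids _ _ (hgen' hDw)]
    rfl
  calc D.interCycle (E.primeInter w)
      = D.interCycle (AlgebraicCycle.map (V.overι (X := X)).left height height E'.cycle) := by
        rw [hE']
    _ = AlgebraicCycle.map (V.overι (X := X)).left height height (D'.interCycle E'.cycle) := h1.symm
    _ = AlgebraicCycle.map (V.overι (X := X)).left height height (E'.interCycle D'.cycle) := by
        rw [hcomm]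
    _ = E.interCycle (AlgebraicCycle.map (V.overι (X := X)).left height height D'.cycle) := h2
    _ = E.interCycle (D.primeInter w) := by rw [hD']

end CartierDivisor

end General

section Iterated

variable {K : Type u} [Field K] {X : SchemeOver K} [IsIntegral X.left] [LocallyOfFiniteType X.hom]

namespace CartierDivisor

/-- **`H · (D · [V]) = D · [V']` when `H` cuts `V` in the single subvariety `V'` with multiplicity
one**: for effective divisors `H, D` on a projective variety, a subvariety `V = closure {w} ⊄ |H|`
with `H · [V] = [V']`, `V' = closure {w'} ⊄ |D|`, one has `H · (D · [V]) = D · [V']` as cycles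
(`interCycle_primeInter_comm`: the only codimension-one subvariety of `V` on `|H|` is `V'`, which is
off `|D|`). [cite: Fulton1998, Theorem 2.4 and Cor. 2.4.2 (pp. 35–38)] -/
theorem interCycle_primeInter_eq_of_primeInter_eq_primeCycle [CompactSpace ↥X.left]
    {H D : CartierDivisor X.left} (hH : H.IsEffective) (hD : D.IsEffective) {w w' : X.left}
    (hHw : H.Avoids w) (hsec : H.primeInter w = primeCycle w') (hDw' : D.Avoids w') :
    H.interCycle (D.primeInter w) = D.primeInter w' := by
  have hne : H.primeInter w w' ≠ 0 := by
    rw [hsec, primeCycle_apply_self]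
    exact one_ne_zero
  have hww' : w ⤳ w' := H.specializes_of_primeInter_ne_zero hne
  have hDw : D.Avoids w := Avoids.of_specializes hww' hDw'
  have hDE : ∀ z : X.left, w ⤳ z → height z + 1 = height w → H.Avoids z ∨ D.Avoids z := by
    intro z hwz hz
    by_cases hHz : H.Avoids z
    · exact Or.inl hHz
    · right
      have hpos := primeInter_pos_of_not_avoids hH hHw hwz hz hHz
      rw [hsec] at hpos
      have hzw' : z = w' := by
        by_contra hzne
        rw [primeCycle_apply_of_ne hzne] at hpos
        exact lt_irrefl _ hpos
      rw [hzw']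
      exact hDw'
  rw [interCycle_primeInter_comm hH hD hHw hDw hDE, hsec, interCycle_primeCycle]

/-- **Iterated intersection with Cartier divisors**: `D_c · (⋯ (D₂ · (D₁ · s)))` for a sequence
`D₁, …, D_c` of Cartier divisors and a cycle `s` (Fulton, Def. 2.3 / §2.4: the classes
`D₁ · … · D_c · α`; here at the level of the tree's representative cycles `interCycle`). [cite: Fulton1998, Def. 2.3 (p. 33) and Def. 2.4.2 (p. 38)] -/
def iterInter : (c : ℕ) → (Fin c → CartierDivisor X.left) → AlgebraicCycle X.left ℤ →
    AlgebraicCycle X.left ℤ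
  | 0, _, s => s
  | c + 1, D, s => (D (Fin.last c)).interCycle (iterInter c (fun k => D k.castSucc) s)

/-- No divisors: `iterInter 0 D s = s`. [folklore] -/
@[simp]
theorem iterInter_zero (D : Fin 0 → CartierDivisor X.left) (s : AlgebraicCycle X.left ℤ) :
    iterInter 0 D s = s := rfl

/-- One more divisor: `iterInter (c+1) D s = D_c · iterInter c (D|_{<c}) s`. [folklore] -/
theorem iterInter_succ {c : ℕ} (D : Fin (c + 1) → CartierDivisor X.left) (s : AlgebraicCycle X.left ℤ) :
    iterInter (c + 1) D s = (D (Fin.last c)).interCycle (iterInter c (fun k => D k.castSucc) s) := rfl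

/-- `c` Cartier divisors cut an `(n + c)`-cycle down to an `n`-cycle. [cite: Fulton1998, Def. 2.3 (p. 33)] -/
theorem iterInter_mem_cyclesOfDim {n : ℕ} :
    ∀ (c : ℕ) (D : Fin c → CartierDivisor X.left) {s : AlgebraicCycle X.left ℤ},
      s ∈ cyclesOfDim X.left (n + c) → iterInter c D s ∈ cyclesOfDim X.left n
  | 0, _, _, hs => hs
  | c + 1, D, s, hs => by
    rw [iterInter_succ]
    refine interCycle_mem_cyclesOfDim _ (iterInter_mem_cyclesOfDim (n := n + 1) c _ ?_)
    have h : n + 1 + c = n + (c + 1) := by omega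
    rw [h]
    exact hs

end CartierDivisor

end Iterated

/-! ### Linear sections in `ℙᴺ` -/

namespace ProjSpace

variable {N : ℕ} {K : Type u} [Field K]

/-- **A linear form in the ideal of linearly independent linear forms is in their span**: the
degree-one part of `(L₁, …, L_t)` is `K L₁ + ⋯ + K L_t`. [folklore] -/
theorem mem_span_of_mem_idealSpan_of_linear {σ : Type*} {t : ℕ} (L : Fin t → MvPolynomial σ K)
    (hL : ∀ j, (L j).IsHomogeneous 1) {G : MvPolynomial σ K} (hG : G ∈ Ideal.span (Set.range L))
    (hG1 : G.IsHomogeneous 1) : G ∈ Submodule.span K (Set.range L) := by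
  obtain ⟨H, hH, hGH⟩ := exists_eq_sum_mul_of_mem_span_of_isHomogeneous L hL hG le_rfl hG1
  rw [hGH]
  refine Submodule.sum_mem _ fun j _ => ?_
  have hHj : H j = MvPolynomial.C ((H j).coeff 0) := by
    rw [← MvPolynomial.totalDegree_eq_zero_iff_eq_C]
    by_cases h0 : H j = 0
    · rw [h0, MvPolynomial.totalDegree_zero]
    · simpa using (hH j).totalDegree h0
  rw [hHj, MvPolynomial.C_mul']
  exact Submodule.smul_mem _ _ (Submodule.subset_span ⟨j, rfl⟩)

/-- For linearly independent linear forms `ℓ₁, …, ℓ_{c+1}`, the last one is not in the ideal of the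
others. [folklore] -/
theorem last_notMem_idealSpan_of_linearIndependent {σ : Type*} {c : ℕ}
    (ℓ : Fin (c + 1) → MvPolynomial σ K) (hhom : ∀ k, (ℓ k).IsHomogeneous 1)
    (hlin : LinearIndependent K ℓ) :
    ℓ (Fin.last c) ∉ Ideal.span (Set.range (fun k : Fin c => ℓ k.castSucc)) := fun hmem => by
  have hsnoc : LinearIndependent K (Fin.snoc (Fin.init ℓ) (ℓ (Fin.last c))) := by
    rw [Fin.snoc_init_self]
    exact hlin
  exact (linearIndependent_finSnoc.1 hsnoc).2
    (mem_span_of_mem_idealSpan_of_linear _ (fun k => hhom _) hmem (hhom _))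

/-- **A point of `ℙᴺ` whose homogeneous prime is generated by `t ≤ N` independent linear forms is
an `(N - t)`-plane point** (for `𝟙 ℙᴺ`; Hartshorne I Ex. 2.11: linear varieties). [cite: Hartshorne1977, I Ex. 2.11] -/
theorem isLinearSubspacePoint_of_toIdeal_eq_span {t : ℕ} (L : Fin t → MvPolynomial (Fin (N + 1)) K)
    (hL : LinearIndependent K L) (hhom : ∀ j, (L j).IsHomogeneous 1) (ht : t ≤ N)
    {w : ↥(projectiveSpace N K).left}
    (hw : (ProjectiveSpectrum.asHomogeneousIdeal
      (𝒜 := MvPolynomial.homogeneousSubmodule (Fin (N + 1)) K) w).toIdeal = Ideal.span (Set.range L)) :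
    IsLinearSubspacePoint (N - t) N (𝟙 (projectiveSpace N K)) w := by
  obtain ⟨p, hp, hht, -⟩ := exists_point_of_linearIndependent L hL hhom ht
  have hwp : w = p := ProjectiveSpectrum.ext (HomogeneousIdeal.toIdeal_injective (hw.trans hp.symm))
  subst hwp
  have hcast : N - (N - t) = t := by omega
  refine ⟨hht, fun j => L (j.cast hcast), hL.comp _ (Fin.cast_injective hcast), fun j => hhom _, ?_⟩
  have hrange : Set.range (fun j : Fin (N - (N - t)) => L (j.cast hcast)) = Set.range L :=
    Function.Surjective.range_comp (g := L) (finCongr hcast).surjective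
  rw [hrange]
  change id '' closure {w} = _
  rw [Set.image_id, closure_singleton_eq_zeroLocus (N := N) (k := K)]
  have hset : ((ProjectiveSpectrum.asHomogeneousIdeal
      (𝒜 := MvPolynomial.homogeneousSubmodule (Fin (N + 1)) K) w :
        HomogeneousIdeal (MvPolynomial.homogeneousSubmodule (Fin (N + 1)) K)) :
          Set (MvPolynomial (Fin (N + 1)) K)) =
      (Ideal.span (Set.range L) : Set (MvPolynomial (Fin (N + 1)) K)) := by
    rw [← hw]
    rfl
  rw [hset, ProjectiveSpectrum.zeroLocus_span]

/-- **A point of `ℙᴺ` with zero homogeneous prime is the generic point.** [folklore] -/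
theorem eq_genericPoint_of_toIdeal_eq_bot {w : ↥(projectiveSpace N K).left}
    (hw : (ProjectiveSpectrum.asHomogeneousIdeal
      (𝒜 := MvPolynomial.homogeneousSubmodule (Fin (N + 1)) K) w).toIdeal = ⊥) :
    w = genericPoint ↥(projectiveSpace N K).left := by
  have hcl : closure ({w} : Set ↥(projectiveSpace N K).left) = Set.univ := by
    rw [closure_singleton_eq_zeroLocus (N := N) (k := K)]
    change ProjectiveSpectrum.zeroLocus _ ((ProjectiveSpectrum.asHomogeneousIdeal
      (𝒜 := MvPolynomial.homogeneousSubmodule (Fin (N + 1)) K) w).toIdeal :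
        Set (MvPolynomial (Fin (N + 1)) K)) = _
    rw [hw]
    exact ProjectiveSpectrum.zeroLocus_bot _
  have hgy : IsGenericPoint w (⊤ : Set ↥(projectiveSpace N K).left) := by
    rw [isGenericPoint_def, hcl]; rfl
  exact hgy.eq (genericPoint_spec ↥(projectiveSpace N K).left)

/-- **`V₊(ℓ₁, …, ℓ_{c+1}) = V₊(ℓ_{c+1}) · [V₊(ℓ₁, …, ℓ_c)]` with multiplicity one**: for linearly
independent linear forms, the hyperplane `V₊(ℓ_{c+1})` cuts the linear subspace of the first `c` forms
in the linear subspace of all `c + 1` forms, with multiplicity one (Fulton, Example 2.5.1: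
`c₁(𝒪(1)) ∩ [Lᵏ] = [Lᵏ⁻¹]`). [cite: Fulton1998, Example 2.5.1 (p. 41)] -/
theorem primeInter_formDivisor_last_eq_primeCycle {c : ℕ} (ℓ : Fin (c + 1) → MvPolynomial (Fin (N + 1)) K)
    (hℓ : ∀ k, ℓ k ∈ grading (Fin (N + 1)) K 1) (hlin : LinearIndependent K ℓ) (hc : c + 1 ≤ N)
    {w₀ w : ↥(projectiveSpace N K).left}
    (hw₀ : (ProjectiveSpectrum.asHomogeneousIdeal
      (𝒜 := MvPolynomial.homogeneousSubmodule (Fin (N + 1)) K) w₀).toIdeal =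
        Ideal.span (Set.range (fun k : Fin c => ℓ k.castSucc)))
    (hw : (ProjectiveSpectrum.asHomogeneousIdeal
      (𝒜 := MvPolynomial.homogeneousSubmodule (Fin (N + 1)) K) w).toIdeal = Ideal.span (Set.range ℓ)) :
    (formDivisor (ℓ (Fin.last c)) (hℓ _) (hlin.ne_zero _)).primeInter (X := projectiveSpace N K) w₀ =
      primeCycle w := by
  set ℓ' : Fin c → MvPolynomial (Fin (N + 1)) K := fun k => ℓ k.castSucc with hℓ'
  have hhom : ∀ k, (ℓ k).IsHomogeneous 1 := fun k => (MvPolynomial.mem_homogeneousSubmodule 1 _).1 (hℓ k)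
  have hlin' : LinearIndependent K ℓ' := hlin.comp Fin.castSucc (Fin.castSucc_injective c)
  have hpl₀ : IsLinearSubspacePoint (N - c) N (𝟙 (projectiveSpace N K)) w₀ :=
    isLinearSubspacePoint_of_toIdeal_eq_span ℓ' hlin' (fun k => hhom _) (by omega) hw₀
  have hpl : IsLinearSubspacePoint (N - (c + 1)) N (𝟙 (projectiveSpace N K)) w :=
    isLinearSubspacePoint_of_toIdeal_eq_span ℓ hlin hhom hc hw
  -- `ℓ_{c+1} ∉ 𝔭_{w₀} = (ℓ₁, …, ℓ_c)`
  have hlast : ℓ (Fin.last c) ∉ ProjectiveSpectrum.asHomogeneousIdeal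
      (𝒜 := MvPolynomial.homogeneousSubmodule (Fin (N + 1)) K) w₀ := by
    intro hmem
    refine last_notMem_idealSpan_of_linearIndependent ℓ hhom hlin ?_
    rw [← hw₀]
    exact hmem
  obtain ⟨w'', hw'', hsec⟩ := exists_primeInter_formDivisor_eq_primeCycle_of_isLinearSubspacePoint
    (by omega) hpl₀ (hℓ (Fin.last c)) (hlin.ne_zero _) hlast
  -- `w'' = w`: `w ⤳ w''` and both have dimension `N - c - 1`
  set H : CartierDivisor (projectiveSpace N K).left := formDivisor (ℓ (Fin.last c)) (hℓ _) (hlin.ne_zero _)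
    with hH
  have hne : H.primeInter (X := projectiveSpace N K) w₀ w'' ≠ 0 := by
    rw [hsec, primeCycle_apply_self]
    exact one_ne_zero
  have hw₀w'' : w₀ ⤳ w'' := H.specializes_of_primeInter_ne_zero (X := projectiveSpace N K) hne
  have hℓw'' : ℓ (Fin.last c) ∈ ProjectiveSpectrum.asHomogeneousIdeal
      (𝒜 := MvPolynomial.homogeneousSubmodule (Fin (N + 1)) K) w'' := by
    by_contra h
    exact H.not_avoids_of_primeInter_ne_zero (X := projectiveSpace N K) hne
      ((formDivisor_avoids_iff (hℓ _) (hlin.ne_zero _) zero_lt_one).2 h)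
  have hww'' : w ⤳ w'' := by
    refine specializes_iff_le.2 ?_
    rw [hw, Ideal.span_le]
    rintro _ ⟨k, rfl⟩
    refine Fin.lastCases ?_ (fun j => ?_) k
    · exact hℓw''
    · have hj : ℓ (Fin.castSucc j) ∈ (ProjectiveSpectrum.asHomogeneousIdeal
          (𝒜 := MvPolynomial.homogeneousSubmodule (Fin (N + 1)) K) w₀).toIdeal := by
        rw [hw₀]
        exact Ideal.subset_span ⟨j, rfl⟩
      exact (specializes_iff_le.1 hw₀w'') hj
  have hheight : height w'' = height w := by
    rw [hw''.1, hpl.1, show N - (c + 1) = N - c - 1 by omega]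
  have hfin : height w < ⊤ := by
    rw [hpl.1]
    exact WithTop.coe_lt_top _
  rw [hsec, ← eq_of_specializes_of_height_eq hww'' hheight hfin]

/-- **`[V₊(F)] · H₁ ⋯ H_c = V₊(F) · [V₊(ℓ₁, …, ℓ_c)]` on `ℙᴺ`**: for a nonzero form `F` of positive
degree and linearly independent linear forms `ℓ₁, …, ℓ_c` (`c ≤ N`) whose common zero locus — the
linear subspace `M = V₊(ℓ₁, …, ℓ_c)` with generic point `w` — is not contained in `V₊(F)`, cutting
the Weil divisor `[V₊(F)]` successively by the hyperplanes `V₊(ℓ_k)` yields the cycle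
`V₊(F) · [M]`, the Weil divisor of `F|_M` (Fulton, §2.4: `D₁ ⋯ D_c · [V]` for properly meeting
divisors is the intersection cycle; Example 2.5.1). [cite: Fulton1998, Theorem 2.4, Cor. 2.4.2 and Example 2.5.1 (pp. 35–41)] -/
theorem iterInter_formDivisor_cycle_eq_primeInter {e : ℕ} (he : 0 < e) {F : MvPolynomial (Fin (N + 1)) K}
    (hF : F ∈ grading (Fin (N + 1)) K e) (hF0 : F ≠ 0) :
    ∀ (c : ℕ) (ℓ : Fin c → MvPolynomial (Fin (N + 1)) K) (hℓ : ∀ k, ℓ k ∈ grading (Fin (N + 1)) K 1)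
      (hlin : LinearIndependent K ℓ) (_hc : c ≤ N) (w : ↥(projectiveSpace N K).left)
      (_hw : (ProjectiveSpectrum.asHomogeneousIdeal
        (𝒜 := MvPolynomial.homogeneousSubmodule (Fin (N + 1)) K) w).toIdeal = Ideal.span (Set.range ℓ))
      (_hFw : F ∉ ProjectiveSpectrum.asHomogeneousIdeal
        (𝒜 := MvPolynomial.homogeneousSubmodule (Fin (N + 1)) K) w),
      CartierDivisor.iterInter (X := projectiveSpace N K) c
          (fun k => formDivisor (ℓ k) (hℓ k) (hlin.ne_zero k)) (formDivisor F hF hF0).cycle =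
        (formDivisor F hF hF0).primeInter (X := projectiveSpace N K) w
  | 0, ℓ, hℓ, hlin, hc, w, hw, hFw => by
    have hbot : (ProjectiveSpectrum.asHomogeneousIdeal
        (𝒜 := MvPolynomial.homogeneousSubmodule (Fin (N + 1)) K) w).toIdeal = ⊥ := by
      rw [hw, Set.range_eq_empty, Ideal.span_empty]
    rw [CartierDivisor.iterInter_zero, eq_genericPoint_of_toIdeal_eq_bot hbot]
    exact ((isEffective_formDivisor hF hF0).primeInter_genericPoint (X := projectiveSpace N K)).symm
  | c + 1, ℓ, hℓ, hlin, hc, w, hw, hFw => by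
    rw [CartierDivisor.iterInter_succ]
    set ℓ' : Fin c → MvPolynomial (Fin (N + 1)) K := fun k => ℓ k.castSucc with hℓ'
    have hhom : ∀ k, (ℓ k).IsHomogeneous 1 :=
      fun k => (MvPolynomial.mem_homogeneousSubmodule 1 _).1 (hℓ k)
    have hlin' : LinearIndependent K ℓ' := hlin.comp Fin.castSucc (Fin.castSucc_injective c)
    obtain ⟨w₀, hw₀, -, -⟩ := exists_point_of_linearIndependent ℓ' hlin' (fun k => hhom _) (by omega)
    have hw₀w : w₀ ⤳ w := by
      refine specializes_iff_le.2 ?_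
      rw [hw₀, hw]
      refine Ideal.span_mono ?_
      rintro _ ⟨k, rfl⟩
      exact ⟨k.castSucc, rfl⟩
    have hFw₀ : F ∉ ProjectiveSpectrum.asHomogeneousIdeal
        (𝒜 := MvPolynomial.homogeneousSubmodule (Fin (N + 1)) K) w₀ :=
      fun h => hFw ((specializes_iff_le.1 hw₀w) h)
    have IH := iterInter_formDivisor_cycle_eq_primeInter he hF hF0 c ℓ' (fun k => hℓ _) hlin'
      (by omega) w₀ hw₀ hFw₀
    rw [IH]
    have hlast : (formDivisor (ℓ (Fin.last c)) (hℓ _) (hlin.ne_zero _)).Avoids w₀ := by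
      refine (formDivisor_avoids_iff (hℓ _) (hlin.ne_zero _) zero_lt_one).2 fun h => ?_
      refine last_notMem_idealSpan_of_linearIndependent ℓ hhom hlin ?_
      rw [← hw₀]
      exact h
    exact CartierDivisor.interCycle_primeInter_eq_of_primeInter_eq_primeCycle (X := projectiveSpace N K)
      (isEffective_formDivisor (hℓ _) (hlin.ne_zero _)) (isEffective_formDivisor hF hF0) hlast
      (primeInter_formDivisor_last_eq_primeCycle ℓ hℓ hlin hc hw₀ hw)
      ((formDivisor_avoids_iff hF hF0 he).2 hFw)

end ProjSpace

/-! ### Iterated hyperplane sections on a subvariety `X ⊆ ℙᴺ`: cycles versus classes -/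

namespace CartierDivisor

variable {K : Type u} [Field K] {X : SchemeOver K} [IsIntegral X.left] [LocallyOfFiniteType X.hom]

/-- First-divisor unfolding of the iterated intersection:
`iterInter (c+1) D s = iterInter c (D ∘ succ) (D₀ · s)`. [folklore] -/
theorem iterInter_succ' :
    ∀ (c : ℕ) (D : Fin (c + 1) → CartierDivisor X.left) (s : AlgebraicCycle X.left ℤ),
      iterInter (c + 1) D s = iterInter c (fun k => D k.succ) ((D 0).interCycle s)
  | 0, _, _ => rfl
  | c + 1, D, s => by
    rw [iterInter_succ, iterInter_succ' c (fun k => D k.castSucc) s, iterInter_succ (fun k => D k.succ)]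
    simp only [Fin.succ_last, Fin.succ_castSucc, Fin.castSucc_zero]

end CartierDivisor

namespace ProjSpace

variable {N : ℕ} {K : Type u} [Field K] [Infinite K] {X : SchemeOver K} [IsIntegral X.left]
  [LocallyOfFiniteType X.hom] (j : X ⟶ projectiveSpace N K) [IsClosedImmersion j.left]
  {ℓ₀ : MvPolynomial (Fin (N + 1)) K} (hℓ₀ : ℓ₀ ∈ grading (Fin (N + 1)) K 1) (hℓ₀0 : ℓ₀ ≠ 0)
  (hX₀ : (formDivisor ℓ₀ hℓ₀ hℓ₀0).Avoids (j.left.base (genericPoint ↥X.left)))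

/-- **The class of `(j^*V₊(ℓ)) · t` is `c₁(𝒪_X(1)) ∩ [t]`** for every hyperplane `V₊(ℓ) ⊅ X`
(`hyperplaneSectionOn_mk` with `hyperplaneSectionOn_congr`). [cite: Fulton1998, §2.5 (p. 41)] -/
theorem mk_interCycle_pullbackAvoiding_eq_hyperplaneSectionOn {ℓ : MvPolynomial (Fin (N + 1)) K}
    (hℓ : ℓ ∈ grading (Fin (N + 1)) K 1) (hℓ0 : ℓ ≠ 0)
    (hX : (formDivisor ℓ hℓ hℓ0).Avoids (j.left.base (genericPoint ↥X.left))) (n : ℕ)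
    {t : AlgebraicCycle X.left ℤ} (ht : t ∈ cyclesOfDim X.left (n + 1)) :
    ChowGroup.mk X.left n ⟨((formDivisor ℓ hℓ hℓ0).pullbackAvoiding j.left hX).interCycle t,
        CartierDivisor.interCycle_mem_cyclesOfDim _ ht⟩ =
      hyperplaneSectionOn j hℓ₀ hℓ₀0 hX₀ n (ChowGroup.mk X.left (n + 1) ⟨t, ht⟩) := by
  rw [hyperplaneSectionOn_congr j hℓ₀ hℓ₀0 hX₀ hℓ hℓ0 hX n, hyperplaneSectionOn_mk]
  rfl

/-- **The iterated hyperplane section `c₁(𝒪_X(1))ᶜ ∩ - : CH_{n+c}(X) → CH_n(X)`** on an integral closed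
subvariety `j : X ↪ ℙᴺ_K` (`K` infinite), the `c`-fold composite of `hyperplaneSectionOn`
(Fulton, §2.5: `c₁(𝒪(1))ᶜ ∩ α`; Mboro, arXiv:1701.04488, p. 8: the classes `H_X^{n-i}`). [cite: Fulton1998, §2.5 (p. 41)] -/
def hyperplaneSectionOnIter (n : ℕ) : (c : ℕ) → (ChowGroup X.left (n + c) →+ ChowGroup X.left n)
  | 0 => AddMonoidHom.id _
  | c + 1 => (hyperplaneSectionOnIter n c).comp (hyperplaneSectionOn j hℓ₀ hℓ₀0 hX₀ (n + c))

/-- `c₁(𝒪_X(1))⁰ ∩ - = id`. [folklore] -/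
@[simp]
theorem hyperplaneSectionOnIter_zero (n : ℕ) (x : ChowGroup X.left (n + 0)) :
    hyperplaneSectionOnIter j hℓ₀ hℓ₀0 hX₀ n 0 x = x := rfl

/-- `c₁(𝒪_X(1))ᶜ⁺¹ ∩ x = c₁(𝒪_X(1))ᶜ ∩ (c₁(𝒪_X(1)) ∩ x)`. [folklore] -/
theorem hyperplaneSectionOnIter_succ (n c : ℕ) (x : ChowGroup X.left (n + (c + 1))) :
    hyperplaneSectionOnIter j hℓ₀ hℓ₀0 hX₀ n (c + 1) x =
      hyperplaneSectionOnIter j hℓ₀ hℓ₀0 hX₀ n c (hyperplaneSectionOn j hℓ₀ hℓ₀0 hX₀ (n + c) x) := rfl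

/-- **Iterated sections by hyperplanes `V₊(ℓ₁), …, V₊(ℓ_c) ⊅ X` represent `c₁(𝒪_X(1))ᶜ ∩ -`**: for an
`(n + c)`-cycle `s` on `X`, the class of `(j^*V₊(ℓ_c)) · (⋯ ((j^*V₊(ℓ₁)) · s))` in `CH_n(X)` is
`c₁(𝒪_X(1))ᶜ ∩ [s]` — in particular it does not depend on the hyperplanes (Fulton, §2.5 with
Cor. 2.4.2). [cite: Fulton1998, §2.5 (p. 41) and Cor. 2.4.2 (p. 38)] -/
theorem mk_iterInter_eq_hyperplaneSectionOnIter (n : ℕ) :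
    ∀ (c : ℕ) (ℓ : Fin c → MvPolynomial (Fin (N + 1)) K) (hℓ : ∀ k, ℓ k ∈ grading (Fin (N + 1)) K 1)
      (hℓ0 : ∀ k, ℓ k ≠ 0)
      (hav : ∀ k, (formDivisor (ℓ k) (hℓ k) (hℓ0 k)).Avoids (j.left.base (genericPoint ↥X.left)))
      {s : AlgebraicCycle X.left ℤ} (hs : s ∈ cyclesOfDim X.left (n + c)),
      ChowGroup.mk X.left n ⟨CartierDivisor.iterInter c
          (fun k => (formDivisor (ℓ k) (hℓ k) (hℓ0 k)).pullbackAvoiding j.left (hav k)) s,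
          CartierDivisor.iterInter_mem_cyclesOfDim c _ hs⟩ =
        hyperplaneSectionOnIter j hℓ₀ hℓ₀0 hX₀ n c (ChowGroup.mk X.left (n + c) ⟨s, hs⟩)
  | 0, _, _, _, _, _, _ => rfl
  | c + 1, ℓ, hℓ, hℓ0, hav, s, hs => by
    have hs₁ : ((formDivisor (ℓ 0) (hℓ 0) (hℓ0 0)).pullbackAvoiding j.left (hav 0)).interCycle s ∈
        cyclesOfDim X.left (n + c) :=
      CartierDivisor.interCycle_mem_cyclesOfDim _ hs
    have IH := mk_iterInter_eq_hyperplaneSectionOnIter n c (fun k => ℓ k.succ) (fun k => hℓ _)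
      (fun k => hℓ0 _) (fun k => hav _) hs₁
    have h1 := mk_interCycle_pullbackAvoiding_eq_hyperplaneSectionOn j hℓ₀ hℓ₀0 hX₀ (hℓ 0) (hℓ0 0)
      (hav 0) (n + c) (t := s) hs
    calc ChowGroup.mk X.left n ⟨CartierDivisor.iterInter (c + 1)
            (fun k => (formDivisor (ℓ k) (hℓ k) (hℓ0 k)).pullbackAvoiding j.left (hav k)) s,
            CartierDivisor.iterInter_mem_cyclesOfDim (c + 1) _ hs⟩
        = ChowGroup.mk X.left n ⟨CartierDivisor.iterInter c
            (fun k => (formDivisor (ℓ k.succ) (hℓ _) (hℓ0 _)).pullbackAvoiding j.left (hav _))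
            (((formDivisor (ℓ 0) (hℓ 0) (hℓ0 0)).pullbackAvoiding j.left (hav 0)).interCycle s),
            CartierDivisor.iterInter_mem_cyclesOfDim c _ hs₁⟩ := by
          congr 1
          exact Subtype.ext (CartierDivisor.iterInter_succ' c
            (fun k => (formDivisor (ℓ k) (hℓ k) (hℓ0 k)).pullbackAvoiding j.left (hav k)) s)
      _ = _ := IH
      _ = hyperplaneSectionOnIter j hℓ₀ hℓ₀0 hX₀ n c
            (hyperplaneSectionOn j hℓ₀ hℓ₀0 hX₀ (n + c) (ChowGroup.mk X.left (n + c + 1) ⟨s, hs⟩)) := by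
          rw [h1]
      _ = _ := rfl

end ProjSpace

/-! ### Linear sections of a hypersurface `X ⊆ ℙ^{d+1}` -/

namespace Hypersurface

variable {K : Type u} [Field K] {d e : ℕ} {X : SchemeOver K} [IsIntegral X.left]
  [LocallyOfFiniteType X.hom] (i : X ⟶ projectiveSpace (d + 1) K) [IsClosedImmersion i.left]
  {F : MvPolynomial (Fin (d + 1 + 1)) K} (hF : F ∈ grading (Fin (d + 1 + 1)) K e) (hprime : Prime F)
  (hrange : Set.range i.left.base =
    ProjectiveSpectrum.zeroLocus (MvPolynomial.homogeneousSubmodule (Fin (d + 1 + 1)) K) {F})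

include hF hprime hrange


open ProjSpace

omit [LocallyOfFiniteType X.hom] in
/-- **Hyperplanes not containing the hypersurface**: `V₊(ℓ) ⊅ X = V₊(F)` — i.e. the divisor `V₊(ℓ)`
avoids `i(η_X) = η_F` — as soon as `F ∉ (ℓ)` (automatic for `deg F ≥ 2`; for a nonzero linear form
`ℓ`, `F ∣ ℓ` forces `F ∈ K^× ℓ` by degrees). [folklore] -/
theorem formDivisor_avoids_base_genericPoint {ℓ : MvPolynomial (Fin (d + 1 + 1)) K}
    (hℓ : ℓ ∈ grading (Fin (d + 1 + 1)) K 1) (hℓ0 : ℓ ≠ 0) (hFℓ : F ∉ Ideal.span {ℓ}) :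
    (formDivisor ℓ hℓ hℓ0).Avoids (i.left.base (genericPoint ↥X.left)) := by
  rw [base_genericPoint_eq i hF hprime hrange]
  refine (formDivisor_avoids_iff hℓ hℓ0 zero_lt_one).2 fun hmem => hFℓ ?_
  have hmem' : ℓ ∈ Ideal.span {F} := by
    rw [← toIdeal_hypersurfacePoint F hF hprime]
    exact hmem
  obtain ⟨G, hG⟩ := Ideal.mem_span_singleton'.1 hmem'
  have hG0 : G ≠ 0 := by
    rintro rfl
    exact hℓ0 (by rw [← hG, zero_mul])
  have hdeg := MvPolynomial.totalDegree_mul_of_isDomain hG0 hprime.ne_zero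
  rw [hG, ((MvPolynomial.mem_homogeneousSubmodule 1 ℓ).1 hℓ).totalDegree hℓ0,
    ((MvPolynomial.mem_homogeneousSubmodule e F).1 hF).totalDegree hprime.ne_zero] at hdeg
  have he := pos_of_mem_grading_of_prime hF hprime
  have hG' : G.totalDegree = 0 := by omega
  rw [MvPolynomial.totalDegree_eq_zero_iff_eq_C] at hG'
  obtain ⟨g, rfl⟩ : ∃ g : K, G = MvPolynomial.C g := ⟨_, hG'⟩
  have hg0 : g ≠ 0 := by
    rintro rfl
    exact hG0 (map_zero _)
  refine Ideal.mem_span_singleton'.2 ⟨MvPolynomial.C g⁻¹, ?_⟩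
  rw [← hG, ← mul_assoc, ← map_mul, inv_mul_cancel₀ hg0, map_one, one_mul]

/-- **`i_*(X · H₁ ⋯ H_c) = V₊(F) · [V₊(ℓ₁, …, ℓ_c)]`: linear sections of a hypersurface, as cycles.**
Let `i : X ↪ ℙ^{d+1}` be a closed immersion of an integral `K`-scheme onto the hypersurface `V₊(F)`
of a prime form `F`, and `ℓ₁, …, ℓ_c` (`c ≤ d + 1`) linearly independent linear forms with
`V₊(ℓ_k) ⊅ X`, cutting out the linear subspace `M = V₊(ℓ₁, …, ℓ_c)` with generic point `w`, not
contained in `X` (`F ∉ 𝔭_w`). Then the iterated section cycle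
`(i^*V₊(ℓ_c)) · (⋯ ((i^*V₊(ℓ₁)) · [X]))` on `X` pushes forward to the intersection cycle
`V₊(F) · [M]` on `ℙ^{d+1}` — the Weil divisor of `F|_M`, i.e. the cycle `[X ∩ M]` of the
hypersurface `X ∩ M` of `M ≅ ℙ^{d+1-c}` counted with multiplicities (Fulton, Thm. 2.4 / Cor. 2.4.2 in
the properly-meeting case, Example 2.5.1; this is the cycle `[S] = [P₀ ∩ X]` of Mboro,
arXiv:1701.04488, proof of Prop. 1.4, p. 8). [cite: Fulton1998, Theorem 2.4, Cor. 2.4.2 and Example 2.5.1 (pp. 35–41)] [cite: Mboro2018, proof of Prop. 1.4 (arXiv:1701.04488, p. 8)] -/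
theorem map_iterInter_primeCycle_eq_primeInter :
    ∀ (c : ℕ) (ℓ : Fin c → MvPolynomial (Fin (d + 1 + 1)) K)
      (hℓ : ∀ k, ℓ k ∈ grading (Fin (d + 1 + 1)) K 1) (hlin : LinearIndependent K ℓ) (_hc : c ≤ d + 1)
      (hav : ∀ k, (formDivisor (ℓ k) (hℓ k) (hlin.ne_zero k)).Avoids (i.left.base (genericPoint ↥X.left)))
      (w : ↥(projectiveSpace (d + 1) K).left)
      (_hw : (ProjectiveSpectrum.asHomogeneousIdeal
        (𝒜 := MvPolynomial.homogeneousSubmodule (Fin (d + 1 + 1)) K) w).toIdeal =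
          Ideal.span (Set.range ℓ))
      (_hFw : F ∉ ProjectiveSpectrum.asHomogeneousIdeal
        (𝒜 := MvPolynomial.homogeneousSubmodule (Fin (d + 1 + 1)) K) w),
      AlgebraicCycle.map i.left height height
          (CartierDivisor.iterInter c
            (fun k => (formDivisor (ℓ k) (hℓ k) (hlin.ne_zero k)).pullbackAvoiding i.left (hav k))
            (primeCycle (genericPoint ↥X.left))) =
        (formDivisor F hF hprime.ne_zero).primeInter (X := projectiveSpace (d + 1) K) w
  | 0, ℓ, hℓ, hlin, hc, hav, w, hw, hFw => by
    have hbot : (ProjectiveSpectrum.asHomogeneousIdeal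
        (𝒜 := MvPolynomial.homogeneousSubmodule (Fin (d + 1 + 1)) K) w).toIdeal = ⊥ := by
      rw [hw, Set.range_eq_empty, Ideal.span_empty]
    rw [CartierDivisor.iterInter_zero, map_primeCycle_genericPoint i hF hprime hrange,
      eq_genericPoint_of_toIdeal_eq_bot hbot]
    exact ((isEffective_formDivisor hF hprime.ne_zero).primeInter_genericPoint
      (X := projectiveSpace (d + 1) K)).symm
  | c + 1, ℓ, hℓ, hlin, hc, hav, w, hw, hFw => by
    haveI : CompactSpace ↥X.left := i.left.isClosedEmbedding.compactSpace
    rw [CartierDivisor.iterInter_succ]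
    set ℓ' : Fin c → MvPolynomial (Fin (d + 1 + 1)) K := fun k => ℓ k.castSucc with hℓ'
    have hhom : ∀ k, (ℓ k).IsHomogeneous 1 :=
      fun k => (MvPolynomial.mem_homogeneousSubmodule 1 _).1 (hℓ k)
    have hlin' : LinearIndependent K ℓ' := hlin.comp Fin.castSucc (Fin.castSucc_injective c)
    obtain ⟨w₀, hw₀, -, -⟩ := exists_point_of_linearIndependent ℓ' hlin' (fun k => hhom _) (by omega)
    have hw₀w : w₀ ⤳ w := by
      refine specializes_iff_le.2 ?_
      rw [hw₀, hw]
      refine Ideal.span_mono ?_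
      rintro _ ⟨k, rfl⟩
      exact ⟨k.castSucc, rfl⟩
    have hFw₀ : F ∉ ProjectiveSpectrum.asHomogeneousIdeal
        (𝒜 := MvPolynomial.homogeneousSubmodule (Fin (d + 1 + 1)) K) w₀ :=
      fun h => hFw ((specializes_iff_le.1 hw₀w) h)
    have IH := map_iterInter_primeCycle_eq_primeInter c ℓ' (fun k => hℓ _) hlin' (by omega)
      (fun k => hav _) w₀ hw₀ hFw₀
    set D : CartierDivisor (projectiveSpace (d + 1) K).left := formDivisor F hF hprime.ne_zero with hD
    set H : CartierDivisor (projectiveSpace (d + 1) K).left :=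
      formDivisor (ℓ (Fin.last c)) (hℓ _) (hlin.ne_zero _) with hH
    have hDe : D.IsEffective := isEffective_formDivisor hF hprime.ne_zero
    have hHe : H.IsEffective := isEffective_formDivisor (hℓ _) (hlin.ne_zero _)
    have he := pos_of_mem_grading_of_prime hF hprime
    have hHw₀ : H.Avoids w₀ := by
      refine (formDivisor_avoids_iff (hℓ _) (hlin.ne_zero _) zero_lt_one).2 fun h => ?_
      refine last_notMem_idealSpan_of_linearIndependent ℓ hhom hlin ?_
      rw [← hw₀]
      exact h
    have hsec : H.primeInter (X := projectiveSpace (d + 1) K) w₀ = primeCycle w :=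
      primeInter_formDivisor_last_eq_primeCycle ℓ hℓ hlin hc hw₀ hw
    have hDw : D.Avoids w := (formDivisor_avoids_iff hF hprime.ne_zero he).2 hFw
    -- the components of the intermediate cycle are off `V₊(ℓ_{c+1})`
    have hsupp : ∀ z, CartierDivisor.iterInter c
        (fun k => (formDivisor (ℓ' k) (hℓ _) (hlin'.ne_zero k)).pullbackAvoiding i.left (hav _))
        (primeCycle (genericPoint ↥X.left)) z ≠ 0 → H.Avoids (i.left.base z) := by
      intro z hz
      have hz' : D.primeInter (X := projectiveSpace (d + 1) K) w₀ (i.left.base z) ≠ 0 := by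
        rw [← IH, algebraicCycleMap_apply_base_of_isClosedImmersion]
        exact hz
      have hw₀z : w₀ ⤳ i.left.base z :=
        D.specializes_of_primeInter_ne_zero (X := projectiveSpace (d + 1) K) hz'
      have hcoh := CartierDivisor.coheight_ofPointPt_eq_one_of_primeInter_ne_zero
        (X := projectiveSpace (d + 1) K) hz' hw₀z
      have hht : height (i.left.base z) + 1 = height w₀ :=
        (coheight_ofPointPt_eq_one_iff_height (X := projectiveSpace (d + 1) K) hw₀z).1 hcoh
      by_contra hHz
      have hpos := CartierDivisor.primeInter_pos_of_not_avoids (X := projectiveSpace (d + 1) K)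
        hHe hHw₀ hw₀z hht hHz
      rw [hsec] at hpos
      have hzw : i.left.base z = w := by
        by_contra hne
        rw [primeCycle_apply_of_ne hne] at hpos
        exact lt_irrefl _ hpos
      apply hFw
      rw [← hzw]
      have hmem : i.left.base z ∈ Set.range i.left.base := ⟨z, rfl⟩
      rw [hrange] at hmem
      exact hmem (Set.mem_singleton F)
    refine (CartierDivisor.map_interCycle_pullbackAvoiding i hHe (hav (Fin.last c)) hsupp
      (finite_support_of_compactSpace _)).trans ?_
    exact (congrArg H.interCycle IH).trans
      (CartierDivisor.interCycle_primeInter_eq_of_primeInter_eq_primeCycle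
        (X := projectiveSpace (d + 1) K) hHe hDe hHw₀ hsec hDw)

/-- **`[X ∩ M] = H_X^c ∩ [X]` in `CH_m(X)`** (Mboro, arXiv:1701.04488, proof of Prop. 1.4, p. 8: "in
`CH₂(X)`, we have `H_X^{n-2} = [S]`" for the cubic surface `S = P₀ ∩ X` cut on the cubic `n`-fold `X`
by a `3`-plane `P₀`; Fulton, Example 2.5.1 / Cor. 2.4.2). For a hypersurface `i : X ≅ V₊(F) ⊆ ℙ^{d+1}`,
`d = m + c`, and hyperplanes `V₊(ℓ₁), …, V₊(ℓ_c) ⊅ X`, the class in `CH_m(X)` of the iterated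
section cycle `(i^*V₊(ℓ_c)) · (⋯ ((i^*V₊(ℓ₁)) · [X]))` — whose push-forward to `ℙ^{d+1}` is the cycle
`V₊(F) · [V₊(ℓ₁, …, ℓ_c)] = [X ∩ M]` when the `ℓ_k` are independent and `M = V₊(ℓ₁, …, ℓ_c) ⊄ X`
(`map_iterInter_primeCycle_eq_primeInter`) — is `c₁(𝒪_X(1))ᶜ ∩ [X]`; in particular it does not
depend on `M`. [cite: Mboro2018, proof of Prop. 1.4 (arXiv:1701.04488, p. 8)] [cite: Fulton1998, Example 2.5.1 and Cor. 2.4.2 (pp. 38–41)] -/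
theorem mk_iterInter_primeCycle_eq_hyperplaneSectionOnIter [Infinite K] {m c : ℕ} (hdim : m + c = d)
    (ℓ : Fin c → MvPolynomial (Fin (d + 1 + 1)) K) (hℓ : ∀ k, ℓ k ∈ grading (Fin (d + 1 + 1)) K 1)
    (hℓ0 : ∀ k, ℓ k ≠ 0)
    (hav : ∀ k, (formDivisor (ℓ k) (hℓ k) (hℓ0 k)).Avoids (i.left.base (genericPoint ↥X.left)))
    {ℓ₀ : MvPolynomial (Fin (d + 1 + 1)) K} (hℓ₀ : ℓ₀ ∈ grading (Fin (d + 1 + 1)) K 1) (hℓ₀0 : ℓ₀ ≠ 0)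
    (hX₀ : (formDivisor ℓ₀ hℓ₀ hℓ₀0).Avoids (i.left.base (genericPoint ↥X.left))) :
    ChowGroup.mk X.left m ⟨CartierDivisor.iterInter c
        (fun k => (formDivisor (ℓ k) (hℓ k) (hℓ0 k)).pullbackAvoiding i.left (hav k))
        (primeCycle (genericPoint ↥X.left)),
        CartierDivisor.iterInter_mem_cyclesOfDim c _ (primeCycle_mem_cyclesOfDim
          (by rw [height_genericPoint i hF hprime hrange]; exact_mod_cast hdim.symm))⟩ =
      hyperplaneSectionOnIter i hℓ₀ hℓ₀0 hX₀ m c (ChowGroup.mk X.left (m + c)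
        ⟨primeCycle (genericPoint ↥X.left), primeCycle_mem_cyclesOfDim
          (by rw [height_genericPoint i hF hprime hrange]; exact_mod_cast hdim.symm)⟩) :=
  mk_iterInter_eq_hyperplaneSectionOnIter i hℓ₀ hℓ₀0 hX₀ m c ℓ hℓ hℓ0 hav _

/-- **The class of a linear section `[X ∩ M]` of a hypersurface does not depend on the linear
subspace**: for two families of `c` hyperplanes not containing `X ≅ V₊(F) ⊆ ℙ^{m+c+1}`, the
iterated section cycles have the same class `c₁(𝒪_X(1))ᶜ ∩ [X]` in `CH_m(X)` (Mboro,
arXiv:1701.04488, p. 8; Fulton, Cor. 2.4.2). [cite: Mboro2018, proof of Prop. 1.4 (arXiv:1701.04488, p. 8)] [cite: Fulton1998, Cor. 2.4.2 (p. 38)] -/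
theorem mk_iterInter_primeCycle_eq_mk_iterInter_primeCycle [Infinite K] {m c : ℕ} (hdim : m + c = d)
    (ℓ ℓ' : Fin c → MvPolynomial (Fin (d + 1 + 1)) K) (hℓ : ∀ k, ℓ k ∈ grading (Fin (d + 1 + 1)) K 1)
    (hℓ0 : ∀ k, ℓ k ≠ 0)
    (hav : ∀ k, (formDivisor (ℓ k) (hℓ k) (hℓ0 k)).Avoids (i.left.base (genericPoint ↥X.left)))
    (hℓ' : ∀ k, ℓ' k ∈ grading (Fin (d + 1 + 1)) K 1) (hℓ'0 : ∀ k, ℓ' k ≠ 0)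
    (hav' : ∀ k, (formDivisor (ℓ' k) (hℓ' k) (hℓ'0 k)).Avoids (i.left.base (genericPoint ↥X.left))) :
    ChowGroup.mk X.left m ⟨CartierDivisor.iterInter c
        (fun k => (formDivisor (ℓ k) (hℓ k) (hℓ0 k)).pullbackAvoiding i.left (hav k))
        (primeCycle (genericPoint ↥X.left)),
        CartierDivisor.iterInter_mem_cyclesOfDim c _ (primeCycle_mem_cyclesOfDim
          (by rw [height_genericPoint i hF hprime hrange]; exact_mod_cast hdim.symm))⟩ =
      ChowGroup.mk X.left m ⟨CartierDivisor.iterInter c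
        (fun k => (formDivisor (ℓ' k) (hℓ' k) (hℓ'0 k)).pullbackAvoiding i.left (hav' k))
        (primeCycle (genericPoint ↥X.left)),
        CartierDivisor.iterInter_mem_cyclesOfDim c _ (primeCycle_mem_cyclesOfDim
          (by rw [height_genericPoint i hF hprime hrange]; exact_mod_cast hdim.symm))⟩ := by
  obtain ⟨l, hl⟩ := exists_formDivisor_avoids_genericPoint i
  rw [mk_iterInter_primeCycle_eq_hyperplaneSectionOnIter i hF hprime hrange hdim ℓ hℓ hℓ0 hav
      (X_mem K l) (MvPolynomial.X_ne_zero l) hl,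
    mk_iterInter_primeCycle_eq_hyperplaneSectionOnIter i hF hprime hrange hdim ℓ' hℓ' hℓ'0 hav'
      (X_mem K l) (MvPolynomial.X_ne_zero l) hl]

end Hypersurface

end Literature.AlgebraicGeometry.Motives

end
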